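import Summits.ABC.IUTFork.Cor312GenuineKLocalType
import Literature.IUT.LogVolume.GenuineThetaFieldTateRoot
import HarnessLib

/-!
# [IUTchIII] Cor. 3.12, branch C / R-W window table — the LOWER local type at the `K`-level pilot datum at EVERY bad
# prime `p ∉ {2, l}`, INCLUDING the wild primes `p ∈ {3, 5}`: `l ∣ e(K_{x₀}/ℚ_p)` and `15·l ∣ e(K_{x₀}/ℚ_p)·t`

PROOF-ONLY support file (D-0012; 0 definitions, 0 `Prop` facts) of the abc-iut cell (R-W «WINDOW Θ-SIDE INEQUALITY», seat
abc-iut-W-neg-1 gen 0; GAP G-Wnum2-1 «WILD LOCAL-TYPE LEMMA», Stages 1 + 2a in fibre form). TAKES NO SIDE on [IUTchIII]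
Cor. 3.12 (S. Mochizuki, *Inter-universal Teichmüller theory III*, RIMS manuscript, Cor. 3.12 p. 173–174) or on any author.

The landed LOCAL-TYPE LEMMA (`Cor312GenuineKLocalType`, p459442) gives the UPPER type `e ∣ 60·l` (`∣ 30·l`, `∣ 15·l`) at the
TAME bad primes `p ∉ {2,3,5,l}`. The INHABITED-side consumers of the R-W window table (abc-iut-W-row-1/2: the U2 licence
wrapper at the 10 OPEN critical-path data, all of which have packets over `3` or `5`) need a LOWER bound on `e(K_{x₀}/ℚ_p)`
at the WILD primes too. This file reads this seat's Stage 1 (`GenuineTowerBadPlaceExact`: `e(u | u∩F) = l` EXACTLY at every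
bad `u ∤ 2l`) and Stage 2a (`GenuineThetaFieldTateRoot`: `E_F` is SPLIT multiplicative at the bad places and `q_w` is a
`30`-th power in `F_w`, so `15 ∣ e(w | v₀)·t` at a pole of `j(λ)` of order `2t`) at the fibre points of the pilot datum:

* `Conditional.GenuineK.absRamificationIdx_kOf_eq_mul_prime_ratPoint` — for a genuine Θ-volume datum `T` at a RATIONAL
  point `(ratPoint q, l)`, a prime `p ∉ {2, l}` at which `j(q)` has a pole, and EVERY fibre point `x₀ | p`:
  `e(K_{x₀}/ℚ_p) = e(w | p)·l` with `w = placeOf x₀ ∩ F` — so **`l ∣ e(K_{x₀}/ℚ_p)`** (`…prime_dvd_absRamificationIdx_kOf_ratPoint`);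
* **`Conditional.GenuineK.fifteen_mul_prime_dvd_absRamificationIdx_kOf_mul_ratPoint`** — if `ord_p j(q) = −2t` (`t ≥ 1`) then
  **`15·l ∣ e(K_{x₀}/ℚ_p)·t`**, i.e. `(15/gcd(15,t))·l ∣ e(K_{x₀}/ℚ_p)`; for `gcd(15, t) = 1`: **`15·l ∣ e(K_{x₀}/ℚ_p)`**
  (`…_of_coprime`). This is the kernel form of the LOWER half of abc-iut W-num-2's wild type `e = l·e_W·r`
  (`r = p′/gcd(p′,t)` and the wild factor `p` of `e_W` when `p ∤ t`), valid at `p ∈ {3, 5}`.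

HONEST FRAMING: bookkeeping over OUR typed objects; nothing here bears on the printed inequality of [IUTchIII] Cor. 3.12 or
on the number-level `Cor22.Cor312AtDatum`; typed ≠ proved; instantiated ≠ endorsed.
[cite: Mochizuki2012, IUTchI Ex. 3.2 (iv) p. 71; IUTchIV Thm. 1.10 p. 22, Cor. 2.2 (ii) proof (P5) p. 46]
[cite: SilvermanATAEC1994, V.5 Thm. 5.3 and Cor. 5.4] [claim: Mochizuki2012, status: disputed] for every IUT quotation.
-/

noncomputable section

open NumberField IsDedekindDomain

namespace Summit.ABC.IUTFork.Conditional

open Thm311 Thm311.Real Cor312 Cor312Prov Literature.IUT.LogVolume Literature.IUT.HodgeTheaters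
  Literature.IUT.LogThetaLattice Literature.NumberTheory.NumberFields Literature.NumberTheory.DiophantineGeometry.GenEll
  Literature.NumberTheory.DiophantineGeometry

/-- **`e(K_{x₀}/ℚ_p) = e(w | p) · l` at every fibre point over a rational pole of `j`, `p ∉ {2, l}`** (`w = placeOf x₀ ∩ F`):
the `l`-division layer contributes EXACTLY `l` (this seat's `ThetaVolumeDatumAt.ramificationIdx_int_eq_mul_prime`), also at
the wild primes `p ∈ {3, 5}`. [cite: Mochizuki2012, IUTchI Ex. 3.2 (iv) p. 71] [claim: Mochizuki2012, status: disputed] -/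
theorem GenuineK.absRamificationIdx_kOf_eq_mul_prime_ratPoint {q : ℚ} {l : ℕ} (T : Cor22.ThetaVolumeDatumAt (ratPoint q) l)
    (pp : Nat.Primes) (hp2 : (pp : ℕ) ≠ 2) (hpl : (pp : ℕ) ≠ l)
    (hpole : ∀ v : HeightOneSpectrum (𝓞 ℚ), Rat.HeightOneSpectrum.natGenerator v = pp →
      Literature.IUT.LogVolume.ord ℚ v (Cor22.jInv q) < 0) :
    letI := T.instFieldF; letI := T.instNumberFieldF; letI := T.instAlgebraF; letI := T.instFieldK
    letI := T.instNumberFieldK; letI := T.instAlgebraK; letI := T.instFieldFbar; letI := T.instAlgebraFbar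
    letI := T.instAlgebraKFbar; letI := T.instIsElliptic
    haveI : Fact (pp : ℕ).Prime := ⟨pp.2⟩
    ∀ x₀ : (thetaIndex (pilotDataOfK T.D T.K)).Fibre (.inr pp),
      absRamificationIdx (pp : ℕ) (kOf (pilotDataOfK T.D T.K) pp.1 x₀) =
        (finBelow T.F T.K (placeOf (pilotDataOfK T.D T.K) pp.1 x₀)).asIdeal.ramificationIdx ℤ * l := by
  letI := T.instFieldF; letI := T.instNumberFieldF; letI := T.instAlgebraF; letI := T.instFieldK
  letI := T.instNumberFieldK; letI := T.instAlgebraK; letI := T.instFieldFbar; letI := T.instAlgebraFbar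
  letI := T.instAlgebraKFbar; letI := T.instIsElliptic
  haveI : Fact (pp : ℕ).Prime := ⟨pp.2⟩
  set X := pilotDataOfK T.D T.K with hXdef
  intro x₀
  set u := placeOf X pp.1 x₀ with hudef
  have hpu : ((pp : ℕ) : 𝓞 T.K) ∈ u.asIdeal := natCast_mem_placeOf X pp.1 x₀
  have huchar : residueChar T.K u = (pp : ℕ) := residueChar_eq_of_natCast_mem pp.1 hpu
  have hekOf : absRamificationIdx (pp : ℕ) (kOf X pp.1 x₀) = u.asIdeal.ramificationIdx ℤ := by
    rw [show absRamificationIdx (pp : ℕ) (kOf X pp.1 x₀) =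
        absRamificationIdx (pp : ℕ) (RescaledCompletion T.K pp.1 (placeOf X pp.1 x₀) hpu) from rfl,
      absRamificationIdx_rescaledCompletion]
  have hu : residueChar T.K u ∉ ({2, l} : Finset ℕ) := by
    rw [huchar]
    simp only [Finset.mem_insert, Finset.mem_singleton, not_or]
    exact ⟨hp2, hpl⟩
  -- the place of `ℚ` under `u` is the pole `p`
  have hbad : finBelow (ratPoint q).F T.F (finBelow T.F T.K u) ∈ Cor22.badPlaces (ratPoint q) := by
    set v : HeightOneSpectrum (𝓞 ℚ) := finBelow (ratPoint q).F T.F (finBelow T.F T.K u) with hvdef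
    have hvp : Rat.HeightOneSpectrum.natGenerator v = pp := by
      have hchar : residueChar ℚ v = pp := by
        rw [hvdef]
        change residueChar (ratPoint q).F (finBelow (ratPoint q).F T.F (finBelow T.F T.K u)) = pp
        rw [residueChar_finBelow, residueChar_finBelow, huchar]
      have hmem : ((pp : ℕ) : 𝓞 ℚ) ∈ v.asIdeal := by
        rw [Cor22.natCast_mem_asIdeal_iff_residueChar_eq v pp.2]; exact hchar
      have hdvd := (UniformABCConjecture.natCast_mem_asIdeal_iff v pp).1 hmem
      exact (Nat.prime_dvd_prime_iff_eq (Rat.HeightOneSpectrum.prime_natGenerator v) pp.2).1 hdvd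
    exact (Cor22.mem_badPlaces_iff_ord_neg (ratPoint q) v).2 (hpole v hvp)
  rw [hekOf]
  exact T.ramificationIdx_int_eq_mul_prime u hu hbad

/-- **`l ∣ e(K_{x₀}/ℚ_p)`** at every fibre point over a rational pole of `j`, `p ∉ {2, l}` (also `p ∈ {3, 5}`).
[cite: Mochizuki2012, IUTchI Ex. 3.2 (iv) p. 71] [claim: Mochizuki2012, status: disputed] -/
theorem GenuineK.prime_dvd_absRamificationIdx_kOf_ratPoint {q : ℚ} {l : ℕ} (T : Cor22.ThetaVolumeDatumAt (ratPoint q) l)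
    (pp : Nat.Primes) (hp2 : (pp : ℕ) ≠ 2) (hpl : (pp : ℕ) ≠ l)
    (hpole : ∀ v : HeightOneSpectrum (𝓞 ℚ), Rat.HeightOneSpectrum.natGenerator v = pp →
      Literature.IUT.LogVolume.ord ℚ v (Cor22.jInv q) < 0) :
    letI := T.instFieldF; letI := T.instNumberFieldF; letI := T.instAlgebraF; letI := T.instFieldK
    letI := T.instNumberFieldK; letI := T.instAlgebraK; letI := T.instFieldFbar; letI := T.instAlgebraFbar
    letI := T.instAlgebraKFbar; letI := T.instIsElliptic
    haveI : Fact (pp : ℕ).Prime := ⟨pp.2⟩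
    ∀ x₀ : (thetaIndex (pilotDataOfK T.D T.K)).Fibre (.inr pp),
      l ∣ absRamificationIdx (pp : ℕ) (kOf (pilotDataOfK T.D T.K) pp.1 x₀) := fun x₀ =>
  ⟨_, (GenuineK.absRamificationIdx_kOf_eq_mul_prime_ratPoint T pp hp2 hpl hpole x₀).trans (mul_comm _ _)⟩

/-- **`15·l ∣ e(K_{x₀}/ℚ_p)·t` at every fibre point over a rational pole of `j` of order `2t`** (`ord_p j(q) = −2t`, `t ≥ 1`,
`p ∉ {2, l}`, including `p ∈ {3, 5}`): the `30`-th root of the Tate parameter in `F_w` (this seat's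
`ThetaVolumeDatumAt.fifteen_dvd_ramificationIdx_mul`) times the exact factor `l` of the `l`-division layer.
[cite: SilvermanATAEC1994, V.5 Thm. 5.3 and Cor. 5.4] [cite: Mochizuki2012, IUTchIV Thm. 1.10 p. 22] [claim: Mochizuki2012, status: disputed] -/
theorem GenuineK.fifteen_mul_prime_dvd_absRamificationIdx_kOf_mul_ratPoint {q : ℚ} {l : ℕ}
    (T : Cor22.ThetaVolumeDatumAt (ratPoint q) l)
    (pp : Nat.Primes) (hp2 : (pp : ℕ) ≠ 2) (hpl : (pp : ℕ) ≠ l) {t : ℕ} (ht : 0 < t)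
    (hpole : ∀ v : HeightOneSpectrum (𝓞 ℚ), Rat.HeightOneSpectrum.natGenerator v = pp →
      Literature.IUT.LogVolume.ord ℚ v (Cor22.jInv q) = -(2 * (t : ℤ))) :
    letI := T.instFieldF; letI := T.instNumberFieldF; letI := T.instAlgebraF; letI := T.instFieldK
    letI := T.instNumberFieldK; letI := T.instAlgebraK; letI := T.instFieldFbar; letI := T.instAlgebraFbar
    letI := T.instAlgebraKFbar; letI := T.instIsElliptic
    haveI : Fact (pp : ℕ).Prime := ⟨pp.2⟩
    ∀ x₀ : (thetaIndex (pilotDataOfK T.D T.K)).Fibre (.inr pp),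
      15 * l ∣ absRamificationIdx (pp : ℕ) (kOf (pilotDataOfK T.D T.K) pp.1 x₀) * t := by
  letI := T.instFieldF; letI := T.instNumberFieldF; letI := T.instAlgebraF; letI := T.instFieldK
  letI := T.instNumberFieldK; letI := T.instAlgebraK; letI := T.instFieldFbar; letI := T.instAlgebraFbar
  letI := T.instAlgebraKFbar; letI := T.instIsElliptic
  haveI : Fact (pp : ℕ).Prime := ⟨pp.2⟩
  have hpole' : ∀ v : HeightOneSpectrum (𝓞 ℚ), Rat.HeightOneSpectrum.natGenerator v = pp →
      Literature.IUT.LogVolume.ord ℚ v (Cor22.jInv q) < 0 := fun v hv => by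
    rw [hpole v hv]
    have : (0 : ℤ) < t := by exact_mod_cast ht
    linarith
  set X := pilotDataOfK T.D T.K with hXdef
  intro x₀
  rw [GenuineK.absRamificationIdx_kOf_eq_mul_prime_ratPoint T pp hp2 hpl hpole' x₀]
  set u := placeOf X pp.1 x₀ with hudef
  set w := finBelow T.F T.K u with hwdef
  -- the place of `ℚ` under `w` is the pole `p`
  set v : HeightOneSpectrum (𝓞 ℚ) := finBelow (ratPoint q).F T.F w with hvdef
  have hpu : ((pp : ℕ) : 𝓞 T.K) ∈ u.asIdeal := natCast_mem_placeOf X pp.1 x₀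
  have huchar : residueChar T.K u = (pp : ℕ) := residueChar_eq_of_natCast_mem pp.1 hpu
  have hvp : Rat.HeightOneSpectrum.natGenerator v = pp := by
    have hchar : residueChar ℚ v = pp := by
      rw [hvdef]
      change residueChar (ratPoint q).F (finBelow (ratPoint q).F T.F (finBelow T.F T.K u)) = pp
      rw [residueChar_finBelow, residueChar_finBelow, huchar]
    have hmem : ((pp : ℕ) : 𝓞 ℚ) ∈ v.asIdeal := by
      rw [Cor22.natCast_mem_asIdeal_iff_residueChar_eq v pp.2]; exact hchar
    have hdvd := (UniformABCConjecture.natCast_mem_asIdeal_iff v pp).1 hmem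
    exact (Nat.prime_dvd_prime_iff_eq (Rat.HeightOneSpectrum.prime_natGenerator v) pp.2).1 hdvd
  -- `e(w | p) = e(w | v)` over `ℚ`
  have hew : w.asIdeal.ramificationIdx ℤ = w.asIdeal.ramificationIdx (𝓞 (ratPoint q).F) := by
    haveI : (finBelow (ratPoint q).F T.F w).asIdeal.IsMaximal := (finBelow (ratPoint q).F T.F w).isMaximal
    have h1 : ramIdx (ratPoint q).F (w.under (𝓞 (ratPoint q).F)) = 1 := by
      rw [ramIdx_eq]
      exact Literature.NumberTheory.EllipticCurves.Fisher2016.ramificationIdx_int_rat_eq_one _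
    rw [ThetaData.absRamificationIdx_eq_ramIdx_mul (F := (ratPoint q).F) w]
    erw [h1, one_mul]
    exact Ideal.ramificationIdx'_eq_ramificationIdx (finBelow (ratPoint q).F T.F w).asIdeal w.asIdeal
      (finBelow (ratPoint q).F T.F w).ne_bot
  have h15 : 15 ∣ w.asIdeal.ramificationIdx (𝓞 (ratPoint q).F) * t :=
    T.fifteen_dvd_ramificationIdx_mul w (by rw [← hvdef]; exact hpole v hvp) ht
  rw [hew, mul_assoc, mul_comm l t, ← mul_assoc]
  exact mul_dvd_mul h15 dvd_rfl

/-- **`15·l ∣ e(K_{x₀}/ℚ_p)` when `gcd(15, t) = 1`** — the generic wild case (`p ∤ t` for `p ∈ {3,5}`) of the R-W window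
table's critical-path data. [cite: SilvermanATAEC1994, V.5 Thm. 5.3 and Cor. 5.4] [claim: Mochizuki2012, status: disputed] -/
theorem GenuineK.fifteen_mul_prime_dvd_absRamificationIdx_kOf_ratPoint_of_coprime {q : ℚ} {l : ℕ}
    (T : Cor22.ThetaVolumeDatumAt (ratPoint q) l)
    (pp : Nat.Primes) (hp2 : (pp : ℕ) ≠ 2) (hpl : (pp : ℕ) ≠ l) {t : ℕ} (ht : 0 < t) (hcop : Nat.Coprime 15 t)
    (hpole : ∀ v : HeightOneSpectrum (𝓞 ℚ), Rat.HeightOneSpectrum.natGenerator v = pp →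
      Literature.IUT.LogVolume.ord ℚ v (Cor22.jInv q) = -(2 * (t : ℤ))) :
    letI := T.instFieldF; letI := T.instNumberFieldF; letI := T.instAlgebraF; letI := T.instFieldK
    letI := T.instNumberFieldK; letI := T.instAlgebraK; letI := T.instFieldFbar; letI := T.instAlgebraFbar
    letI := T.instAlgebraKFbar; letI := T.instIsElliptic
    haveI : Fact (pp : ℕ).Prime := ⟨pp.2⟩
    ∀ x₀ : (thetaIndex (pilotDataOfK T.D T.K)).Fibre (.inr pp),
      15 * l ∣ absRamificationIdx (pp : ℕ) (kOf (pilotDataOfK T.D T.K) pp.1 x₀) := by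
  letI := T.instFieldF; letI := T.instNumberFieldF; letI := T.instAlgebraF; letI := T.instFieldK
  letI := T.instNumberFieldK; letI := T.instAlgebraK; letI := T.instFieldFbar; letI := T.instAlgebraFbar
  letI := T.instAlgebraKFbar; letI := T.instIsElliptic
  haveI : Fact (pp : ℕ).Prime := ⟨pp.2⟩
  intro x₀
  have h := GenuineK.fifteen_mul_prime_dvd_absRamificationIdx_kOf_mul_ratPoint T pp hp2 hpl ht hpole x₀
  have hl : l ∣ absRamificationIdx (pp : ℕ) (kOf (pilotDataOfK T.D T.K) pp.1 x₀) :=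
    GenuineK.prime_dvd_absRamificationIdx_kOf_ratPoint T pp hp2 hpl (fun v hv => by
      rw [hpole v hv]; have : (0 : ℤ) < t := by exact_mod_cast ht
      linarith) x₀
  -- `15 ∣ e·t` with `gcd(15,t) = 1` gives `15 ∣ e`; and `l ∣ e` with `gcd(15, l)`… combine via `15·l ∣ e·t` and coprimality of `t` to `15`
  obtain ⟨e₁, he₁⟩ := hl
  rw [he₁] at h ⊢
  have hl0 : 0 < l := T.D.l_prime.pos
  have h' : l * 15 ∣ l * (e₁ * t) := by rw [mul_comm l 15, ← mul_assoc]; exact h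
  have h15 : 15 ∣ e₁ * t := Nat.dvd_of_mul_dvd_mul_left hl0 h'
  have h15' : 15 ∣ e₁ := hcop.dvd_of_dvd_mul_right h15
  rw [mul_comm 15 l]
  exact mul_dvd_mul_left l h15'

end Summit.ABC.IUTFork.Conditional

end
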